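import Literature.AnabelianGeometry.EtaleTheta.Discharge.Sec3Cor38StdIsoNotGL
import Literature.AnabelianGeometry.EtaleTheta.Discharge.Sec3Thm37Holds
import Literature.AnabelianGeometry.EtaleTheta.Discharge.Sec3Cor38Thm34RowsTreeVocab
import Literature.AlgebraicGeometry.Frobenioids.EquivalenceThm34OfThm34ii
import Literature.AlgebraicGeometry.Frobenioids.Cor411iiOfPreSteps
import Literature.AlgebraicGeometry.Frobenioids.Cor411iiiOfFSMType
import Literature.AlgebraicGeometry.Frobenioids.ModelFrobenioidBiratNormalized
import HarnessLib

/-!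
# [EtTh] Cor 3.8 (ii), proof row C38-L04 case (ii): the base squares of [FrdI] Cor 4.11 (ii) for `Ψ`, `Ψ⁻¹` at the
# canonical [FrdI] vocabulary over Div-slim bases of FSMFF-type — EXACTLY print's hypotheses (FACT-LIST rows
# F-2813, F-2814, F-2812 without the FSM-type proviso)

S. Mochizuki, *The étale theta function and its Frobenioid-theoretic manifestations*, Publ. RIMS **45** (2009)
[MochizukiEtTh2009], Cor. 3.8 (ii) and its proof, PDF pp.80–81 (printed 306–307): "Suppose … `D_i` … is Div-slim …
By applying … [Mzk17], Theorem 3.4, (ii); [Mzk17], Corollary 4.11, (ii), in the case of assertion (ii), it follows that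
`Ψ` preserves the submonoids '`O^▷(−)`'" [cite: MochizukiEtTh2009, Cor 3.8 p.81]; S. Mochizuki, *The geometry of
Frobenioids I*, Kyushu J. Math. **62** (2008), Cor. 4.11 (ii) p.91, Prop. 4.4 (ii) p.83 (the author's *Comments*, 2024
form), Prop. 3.2 (iii) p.58, Def. 4.5 (i) p.86 [cite: MochizukiFrdI2008, Cor. 4.11 (ii) p.91].

PROOF-ONLY companion (cell abc-iut, seat abc-iut-f-001; sequel of `Sec3Cor38BaseSquaresTreeVocab.lean` p430236, which
proved rows F-2813/F-2814 over bases of FSM-type because it went through `PreFrobenioid.cor411ii_ofFunctor_of_isOfFSMType`).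
Here the FSM-type proviso is REMOVED: the tree's base-free [FrdI] Cor. 4.11 (ii) from "`Ψ`, `Ψ⁻¹` preserve pre-steps"
(abc-iut-L1-d6's `PreFrobenioid.cor411ii_of_preservesPreSteps_of_not_isOfGroupLikeType`, `Cor411iiOfPreSteps.lean`) asks,
besides pre-step preservation (row C38-L02a ⟸ [FrdI] Thm. 3.4 (ii) = the named fact `h34 := FrdI.Thm34ii`, F-0711, a
tree theorem), only that "the perfections `(C_i^istr)^pf` and their birationalizations are Frobenioids" — and both
are THEOREMS for the Frobenioid of a tempered Frobenioid at the canonical vocabulary: [FrdI] Prop. 3.2 (iii)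
(`PreFrobenioid.isFrobenioid_perfection_istr`) and [FrdI] Prop. 4.4 (ii) (2024 form) at the perfection of the isotropic
part (`PreFrobenioid.isFrobenioid_birat_perfection_istr`, abc-iut-L6-t20 / L1 lineage) GIVEN "`C` of birationally
Frobenius-normalized type" (Def. 4.5 (i)) — which a MODEL Frobenioid with divisorial `Φ` and group-like `B` is
(abc-iut-L1's `ModelFrobenioid.isOfBiratFrobeniusNormalizedType_of_isDivisorial`; `Φ` divisorial = the canonical
vocabulary's `isDivisorialOn`, `B` group-like = [EtTh] Def. 3.3 `T.isUnit_BΛ`).  Hence, modulo `h34` and the L2 standing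
residual `hBmon_i : IsMonoidOn C_i.ratFnFunctor` ONLY:

* **`Cor38Hyp.cor411ii_treeCatVocab'`** / `cor411ii_symm_treeCatVocab'` — the typed [FrdI] Cor. 4.11 (ii) conclusion
  (`PreFrobenioidData.Cor411ii`) for `Ψ` and for `Ψ⁻¹`, with NO hypothesis on the bases beyond `Cor38Hyp` (FSMFF-type);
* **`Cor38Hyp.baseSquare_treeCatVocab`** / **`baseSquareInv_treeCatVocab`** (rows F-2813 / F-2814 under print's exact
  hypothesis "`D_i` Div-slim"): the `1`-unique `Ψ^Base`, `(Ψ⁻¹)^Base`;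
* **`Cor38Hyp.preservesOTri_treeCatVocab_of_isDivSlim'`** (row F-2812, CASE (ii) as printed), linearity being row F-2815's
  `preservesLinear_treeCatVocab` (`Sec3Cor38Thm34RowsTreeVocab.lean`, p430635), pre-step preservation its
  `preservesPreSteps_treeCatVocab`.

HONEST FRAMING: refereed pre-IUT material; rows proved AT THE CANONICAL VOCABULARY (plan rule R5) modulo the displayed
`h34` (a tree theorem, binder until its olean is served) and `hBmon_i`; nothing of either paper is restated or
strengthened; no definition; nothing here bears on [IUTchIII] Cor. 3.12; typed ≠ proved elsewhere.
-/

namespace Literature.AnabelianGeometry.EtaleTheta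

open CategoryTheory Opposite Literature.AlgebraicGeometry.Frobenioids

universe u₀ v₀ u v w

namespace Cor38Hyp

section TreeVocab

variable {D₀ : Type u₀} [Category.{v₀} D₀] {D₀' : Type u₀} [Category.{v₀} D₀']
  {T : RealifiedDivisorMonoids (D₀ := D₀) treeMonoidVocab.{w}}
  {T' : RealifiedDivisorMonoids (D₀ := D₀') treeMonoidVocab.{w}}
  {D : Type u} [Category.{v} D] {D' : Type u} [Category.{v} D']
  {IsRational IsStrictlyRational : (Dᵒᵖ ⥤ CommMonCat.{w}) → Prop}
  {IsRational' IsStrictlyRational' : (D'ᵒᵖ ⥤ CommMonCat.{w}) → Prop}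
  {C₁ : TemperedFrobenioid T D (treeCatVocab D IsRational IsStrictlyRational)}
  {C₂ : TemperedFrobenioid T' D' (treeCatVocab D' IsRational' IsStrictlyRational')}
  (h : Cor38Hyp C₁ C₂) (h34 : Literature.AlgebraicGeometry.Frobenioids.FrdI.Thm34ii.{w, v, max v w, u, max u w})

include h34

/-- **[FrdI] Cor. 4.11 (ii) for `Ψ` at the canonical vocabulary, NO hypothesis on the bases beyond FSMFF-type** (case (ii)
of C38-L04, p.81: "[Mzk17], Theorem 3.4, (ii); [Mzk17], Corollary 4.11, (ii)"): the typed conclusion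
`C₁.opsData.Cor411ii C₂.opsData h.Ψ`, by L1-d6's base-free `cor411ii_of_preservesPreSteps_of_not_isOfGroupLikeType` fed
with — pre-step preservation for `Ψ`, `Ψ⁻¹` ([FrdI] Thm. 3.4 (ii) = `h34`, quasi-isotropic type from Thm. 3.7 (i),
`h.fsmff`); "`Φ_i` perf-factorial" (field `isPerfFactorial` at `treeMonoidVocab`); "`C_i` not of group-like type" (Thm. 3.7
(i)); "`(C_i^istr)^pf` is a Frobenioid" ([FrdI] Prop. 3.2 (iii), `isFrobenioid_perfection_istr`); "its birationalization is
a Frobenioid" ([FrdI] Prop. 4.4 (ii), 2024 form, `isFrobenioid_birat_perfection_istr`, from "birationally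
Frobenius-normalized type", `ModelFrobenioid.isOfBiratFrobeniusNormalizedType_of_isDivisorial`: `Φ_i` divisorial, `B_i`
group-like); modulo `h34`, `hBmon₁`, `hBmon₂`. [cite: MochizukiEtTh2009, Cor 3.8 p.81] -/
theorem cor411ii_treeCatVocab' (hBmon₁ : IsMonoidOn C₁.ratFnFunctor) (hBmon₂ : IsMonoidOn C₂.ratFnFunctor) :
    C₁.opsData.Cor411ii C₂.opsData h.Ψ := by
  have hF₁ := C₁.isFrobenioid_treeCatVocab_of_isMonoidOn hBmon₁
  have hF₂ := C₂.isFrobenioid_treeCatVocab_of_isMonoidOn hBmon₂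
  have hps : h.PreservesPreSteps := h.preservesPreSteps_treeCatVocab h34 hBmon₁ hBmon₂
  have hPf₁ := PreFrobenioid.isFrobenioid_perfection_istr hF₁
  have hPf₂ := PreFrobenioid.isFrobenioid_perfection_istr hF₂
  have hnb₁ := ModelFrobenioid.isOfBiratFrobeniusNormalizedType_of_isDivisorial hF₁
    (PreFrobenioid.hasBiratSquares_of_isFrobenioid hF₁) C₁.isDivisorial_divisorMonoid
    (C₁.ratFnFunctor_isGroupLike T.isUnit_BΛ)
  have hnb₂ := ModelFrobenioid.isOfBiratFrobeniusNormalizedType_of_isDivisorial hF₂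
    (PreFrobenioid.hasBiratSquares_of_isFrobenioid hF₂) C₂.isDivisorial_divisorMonoid
    (C₂.ratFnFunctor_isGroupLike T'.isUnit_BΛ)
  exact PreFrobenioid.cor411ii_of_preservesPreSteps_of_not_isOfGroupLikeType hF₁ hF₂ h.Ψ
    (fun A => C₁.isPerfFactorial (op A)) (fun A => C₂.isPerfFactorial (op A)) hps.1 hps.2
    C₁.opsData_not_isOfGroupLikeType C₂.opsData_not_isOfGroupLikeType hPf₁ hPf₂
    (PreFrobenioid.isFrobenioid_birat_perfection_istr hF₁ hnb₁ hPf₁)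
    (PreFrobenioid.isFrobenioid_birat_perfection_istr hF₂ hnb₂ hPf₂)

/-- The same for `Ψ⁻¹`. [cite: MochizukiEtTh2009, Cor 3.8 p.81] -/
theorem cor411ii_symm_treeCatVocab' (hBmon₁ : IsMonoidOn C₁.ratFnFunctor) (hBmon₂ : IsMonoidOn C₂.ratFnFunctor) :
    C₂.opsData.Cor411ii C₁.opsData h.Ψ.symm := by
  have hF₁ := C₁.isFrobenioid_treeCatVocab_of_isMonoidOn hBmon₁
  have hF₂ := C₂.isFrobenioid_treeCatVocab_of_isMonoidOn hBmon₂
  have hps : h.PreservesPreSteps := h.preservesPreSteps_treeCatVocab h34 hBmon₁ hBmon₂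
  have hPf₁ := PreFrobenioid.isFrobenioid_perfection_istr hF₁
  have hPf₂ := PreFrobenioid.isFrobenioid_perfection_istr hF₂
  have hnb₁ := ModelFrobenioid.isOfBiratFrobeniusNormalizedType_of_isDivisorial hF₁
    (PreFrobenioid.hasBiratSquares_of_isFrobenioid hF₁) C₁.isDivisorial_divisorMonoid
    (C₁.ratFnFunctor_isGroupLike T.isUnit_BΛ)
  have hnb₂ := ModelFrobenioid.isOfBiratFrobeniusNormalizedType_of_isDivisorial hF₂
    (PreFrobenioid.hasBiratSquares_of_isFrobenioid hF₂) C₂.isDivisorial_divisorMonoid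
    (C₂.ratFnFunctor_isGroupLike T'.isUnit_BΛ)
  exact PreFrobenioid.cor411ii_of_preservesPreSteps_of_not_isOfGroupLikeType hF₂ hF₁ h.Ψ.symm
    (fun A => C₂.isPerfFactorial (op A)) (fun A => C₁.isPerfFactorial (op A)) hps.2 hps.1
    C₂.opsData_not_isOfGroupLikeType C₁.opsData_not_isOfGroupLikeType hPf₂ hPf₁
    (PreFrobenioid.isFrobenioid_birat_perfection_istr hF₂ hnb₂ hPf₂)
    (PreFrobenioid.isFrobenioid_birat_perfection_istr hF₁ hnb₁ hPf₁)

/-- **Row F-2813 at the canonical vocabulary under print's exact hypothesis** (Cor. 3.8 (ii): "`D_i` … Div-slim [relative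
to `Φ_i`]"): the `1`-unique `Ψ^Base : D₁ → D₂` of [FrdI] Cor. 4.11 (ii) under `Ψ`, in the setting (Div-slim; C38-L01 at
the canonical vocabulary, abc-iut-w5-d135; hypothesis (b) vacuous); modulo `h34`, `hBmon₁`, `hBmon₂` — the FSM-type
proviso of `baseSquare_treeCatVocab_of_isOfFSMType` dropped. [cite: MochizukiEtTh2009, Cor 3.8 p.81] -/
theorem baseSquare_treeCatVocab (hBmon₁ : IsMonoidOn C₁.ratFnFunctor) (hBmon₂ : IsMonoidOn C₂.ratFnFunctor)
    (hds : C₁.opsData.IsDivSlim ∧ C₂.opsData.IsDivSlim) : h.BaseSquare :=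
  h.baseSquare_of_cor411ii (h.cor411ii_treeCatVocab' h34 hBmon₁ hBmon₂) hds
    (h.standardIsotropicNotGroupLike_treeCatVocab hBmon₁ hBmon₂)
    (fun h₁ _ => absurd h₁ C₁.opsData_not_isOfGroupLikeType)

/-- **Row F-2814 at the canonical vocabulary under print's exact hypothesis**: the `1`-unique `(Ψ⁻¹)^Base : D₂ → D₁`, for
`D₁`, `D₂` Div-slim; modulo `h34`, `hBmon₁`, `hBmon₂`. [cite: MochizukiEtTh2009, Cor 3.8 p.81] -/
theorem baseSquareInv_treeCatVocab (hBmon₁ : IsMonoidOn C₁.ratFnFunctor) (hBmon₂ : IsMonoidOn C₂.ratFnFunctor)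
    (hds : C₁.opsData.IsDivSlim ∧ C₂.opsData.IsDivSlim) : h.BaseSquareInv :=
  h.baseSquareInv_of_cor411ii (h.cor411ii_symm_treeCatVocab' h34 hBmon₁ hBmon₂) hds
    (h.standardIsotropicNotGroupLike_treeCatVocab hBmon₁ hBmon₂)
    (fun h₂ _ => absurd h₂ C₂.opsData_not_isOfGroupLikeType)

/-- **Row F-2812 / C38-L04, CASE (ii) EXACTLY AS PRINTED, at the canonical vocabulary** ("Suppose … `D_i` … is Div-slim …
`Ψ` preserves the submonoids '`O^▷(−)`'", pp.80–81): for `D₁`, `D₂` Div-slim (of FSMFF-type only, `h.fsmff`), `Ψ` and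
`Ψ⁻¹` preserve `O^▷(−)` = base-identity linear endomorphisms — from the two Cor. 4.11 (ii) base squares and linearity
(`preservesOTri_of_baseSquare`); modulo `h34`, `hBmon₁`, `hBmon₂`. [cite: MochizukiEtTh2009, Cor 3.8 p.81] -/
theorem preservesOTri_treeCatVocab_of_isDivSlim' (hBmon₁ : IsMonoidOn C₁.ratFnFunctor)
    (hBmon₂ : IsMonoidOn C₂.ratFnFunctor) (hds : C₁.opsData.IsDivSlim ∧ C₂.opsData.IsDivSlim) : h.PreservesOTri :=
  h.preservesOTri_of_baseSquare (h.baseSquare_treeCatVocab h34 hBmon₁ hBmon₂ hds)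
    (h.baseSquareInv_treeCatVocab h34 hBmon₁ hBmon₂ hds) (h.preservesLinear_treeCatVocab h34 hBmon₁ hBmon₂)

end TreeVocab

end Cor38Hyp

end Literature.AnabelianGeometry.EtaleTheta
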